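import Summits.CriticalPhenomena.PercolationContinuityZ3.Theorems.Transplant.FKConnectivityAllQAntipodalRootForm3RealDefs
import Summits.CriticalPhenomena.PercolationContinuityZ3.Theorems.Transplant.FKConnectivityAllQAntipodalRootForm3BasePar
import Summits.CriticalPhenomena.PercolationContinuityZ3.Theorems.Transplant.FKConnectivityAllQAntipodalRootFormHost

/-!
# Connectivity correlation inequalities for `φ_{w,q}`, every `q > 0` — ROOT-FORM CALCULUS, file 74b: the THREE-SPECIAL ROOT IDENTITY
# (the levelwise `T2` form of a host `x ∥ 𝓔` is minus the generic root functional of the real three-special environment of `𝓔`)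

Support file (`--supports stmt-CriticalPhenomena-4575`), FK sub-lane `prim-bschramm-fk-2` (gen 32); builds on p205010 (kernel theorem,
internal audit signed; external expert review pending).  No definitions, no named facts, no sorries; standard axioms.  Memo
FROM-fk-2-g31-DUALITY.md §1/§6, FROM-fk-2-g32-*.md; FK-Q2 §41.  This is file 61n (`FK.RootForm.host_root_identity`) for three specials.

Host `H = x ∥ 𝓔`: `𝓔` an edge set with poles `a, b`, special edges `y, z, w`, cell `M` (free) / `C` (contracted); root `x = ab` a further free
special edge; `f = T2_x = ω_x·(ω_y ∨ ω_z ∨ ω_w) ∨ ω_y ω_z ω_w` (ray 19 of the level-4 odd cone, `FK.OddCone.ray4_val19`); `g` increasing and blind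
to `x, y, z, w`.  Then the level-`J` partial sum of the antipodal form of `f` against `g` on the cell `(M ∪ {x,y,z,w}, C)` equals
`−Gen.gMt (realEnv3 M C a b y z w) ĝ ĝ (J+1)` with `ĝ(β) = g(β ∪ C) − g((M \ β) ∪ C)` (`host_root_identity3`: sign class `(−,−)` at the empty
pattern, `(+,+)` at the full pattern, `(+,−)` at the six mixed patterns; the root contributes its pole bit to the level,
`FK.apExpC_insert_root_live₁/₂`; `Gen.EDat.gslot_sum`).  The real environment is antisymmetric under `β ↦ M \ β` (replicas swapped, patterns
complemented: `realEnv3_slotSum_compl`, from `compl_patSet3` + `realPDat_compl` + the generic `Gen.EDat.gslot_sum_swap`), so the root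
functional does not see added constants (`gMt_realEnv3_add_const`) and **`t2_levels_le_nonpos_of_rootFact3`**: fact 1 of the generic word
theorem for `realEnv3 M C a b y z w` (nonnegativity of `Gen.gMt` on monotone nonnegative weights) implies that every level partial sum of the
`T2_x` form of `x ∥ 𝓔` is `≤ 0`, i.e. `Z_H(z,q)² Cov_{φ_{z,q}}(T2_x, g) ∈ (q−1)·ℝ≥0[z,q]` on that cell.
[cite: Grimmett2006, §1.4 eq. (1.20) (p. 15); §3.8 (pp. 61–62)] [cite: Wagner2006, Thm. 5.8(d), §5.3]
-/

noncomputable section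

namespace Summit.CriticalPhenomena.PercolationContinuityZ3.Theorems

namespace FK

namespace RootForm

open SimpleGraph Finset Literature.Probability.LatticeModels Literature.Probability.Percolation
open scoped Classical

/-! ## Generic slot algebra (any number of specials) -/

namespace Gen

variable {ι : Type*} [Fintype ι] [DecidableEq ι]

/-- The two slots together: `gslot₁ + gslot₀ = Σ_b [Λ_∅+K^b ≤ J] − Σ_b [Λ_univ+K^b ≤ J] − Σ_{P mixed} ([Λ_P+K¹_P ≤ J] − [Λ_P+K²_P ≤ J])`. [folklore] -/
theorem EDat.gslot_sum (e : EDat ι) (J : ℤ) : e.gslot1 J + e.gslot0 J =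
    (e.d ∅).a1 J + (e.d ∅).a2 J - (e.d Finset.univ).a1 J - (e.d Finset.univ).a2 J - ∑ P ∈ mixed ι, ((e.d P).a1 J - (e.d P).a2 J) := by
  simp only [EDat.gslot1, EDat.gslot0, PDat.a1_sub_a2, Finset.sum_sub_distrib]
  ring

/-- Complementation permutes the mixed patterns. [folklore] -/
theorem compl_mem_mixed {P : Finset ι} (hP : P ∈ mixed ι) : Pᶜ ∈ mixed ι := by
  simp only [mixed, Finset.mem_filter, Finset.mem_powerset] at hP ⊢
  exact ⟨Finset.subset_univ _, fun h => hP.2.2 ((Finset.compl_eq_empty_iff _).1 h), fun h => hP.2.1 ((Finset.compl_eq_univ_iff _).1 h)⟩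

/-- A sum over the mixed patterns is invariant under complementation. [folklore] -/
theorem sum_mixed_compl (F : Finset ι → ℝ) : ∑ P ∈ mixed ι, F Pᶜ = ∑ P ∈ mixed ι, F P :=
  Finset.sum_nbij' (fun P => Pᶜ) (fun P => Pᶜ) (fun _ hP => compl_mem_mixed hP) (fun _ hP => compl_mem_mixed hP)
    (fun P _ => compl_compl P) (fun P _ => compl_compl P) (fun _ _ => rfl)

/-- Replica swap with pattern complement negates the slot sum. [folklore] -/
theorem EDat.gslot_sum_swap (e e' : EDat ι) (h : ∀ P, e'.d P = ⟨(e.d Pᶜ).lam, (e.d Pᶜ).k2, (e.d Pᶜ).k1⟩) (J : ℤ) :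
    e'.gslot1 J + e'.gslot0 J = -(e.gslot1 J + e.gslot0 J) := by
  rw [EDat.gslot_sum, EDat.gslot_sum]
  have swap : ∀ P, (e'.d P).a1 J - (e'.d P).a2 J = -((e.d Pᶜ).a1 J - (e.d Pᶜ).a2 J) := fun P => by
    rw [h P]; simp only [PDat.a1, PDat.a2]; ring
  have s0 : (e'.d ∅).a1 J + (e'.d ∅).a2 J = (e.d Finset.univ).a1 J + (e.d Finset.univ).a2 J := by
    rw [h ∅]; simp only [PDat.a1, PDat.a2, Finset.compl_empty]; ring
  have s1 : (e'.d Finset.univ).a1 J + (e'.d Finset.univ).a2 J = (e.d ∅).a1 J + (e.d ∅).a2 J := by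
    rw [h Finset.univ]; simp only [PDat.a1, PDat.a2, Finset.compl_univ]; ring
  simp only [swap, Finset.sum_neg_distrib]
  rw [sum_mixed_compl (fun P => (e.d P).a1 J - (e.d P).a2 J)]
  linarith

variable {C : Type*} [Fintype C] [Preorder C]

omit [Preorder C] in
/-- The un-nested generic root functional. [folklore] -/
theorem gMt_self (E : Env ι C) (h : C → ℝ) (J : ℤ) : gMt E h h J = ∑ γ, h γ * ((E γ).gslot1 J + (E γ).gslot0 J) := by
  unfold gMt; exact Finset.sum_congr rfl fun γ _ => by ring

end Gen

/-! ## The real three-special environment: antisymmetry -/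

section RealEnv3

variable {V : Type*} [Fintype V] {M C : Finset (Sym2 V)} {a b : V} {y z w : Sym2 V}

/-- Pattern data at the complementary configuration: same level, pole bits swapped, pattern complemented. [folklore] -/
theorem realEnv3_d_compl (hyM : y ∉ M) (hzM : z ∉ M) (hwM : w ∉ M) (hyz : y ≠ z) (hyw : y ≠ w) (hzw : z ≠ w)
    (β : ↥M.powerset) (P : Finset (Fin 3)) :
    (realEnv3 M C a b y z w ⟨M \ β.1, Finset.mem_powerset.2 Finset.sdiff_subset⟩).d P =
      ⟨((realEnv3 M C a b y z w β).d Pᶜ).lam, ((realEnv3 M C a b y z w β).d Pᶜ).k2, ((realEnv3 M C a b y z w β).d Pᶜ).k1⟩ := by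
  have hX : β.1 ⊆ M := Finset.mem_powerset.1 β.2
  rw [realEnv3_d, realEnv3_d]
  have e1 : patSet3 y z w P (M \ β.1) = insert y (insert z (insert w M)) \ patSet3 y z w Pᶜ β.1 := by
    rw [compl_patSet3 y z w hyM hzM hwM hyz hyw hzw hX Pᶜ, compl_compl]
  rw [e1]
  exact realPDat_compl (patSet3_subset y z w Pᶜ hX)

/-- **Antisymmetry of the real three-special environment**: at `M \ β` the slot sum is minus that at `β`. [folklore] -/
theorem realEnv3_slotSum_compl (hyM : y ∉ M) (hzM : z ∉ M) (hwM : w ∉ M) (hyz : y ≠ z) (hyw : y ≠ w) (hzw : z ≠ w)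
    (β : ↥M.powerset) (J : ℤ) :
    (realEnv3 M C a b y z w ⟨M \ β.1, Finset.mem_powerset.2 Finset.sdiff_subset⟩).gslot1 J +
        (realEnv3 M C a b y z w ⟨M \ β.1, Finset.mem_powerset.2 Finset.sdiff_subset⟩).gslot0 J =
      -((realEnv3 M C a b y z w β).gslot1 J + (realEnv3 M C a b y z w β).gslot0 J) :=
  Gen.EDat.gslot_sum_swap _ _ (fun P => realEnv3_d_compl hyM hzM hwM hyz hyw hzw β P) J

/-- **The generic root functional of the real three-special environment does not see added constants.** [folklore] -/
theorem gMt_realEnv3_add_const (hyM : y ∉ M) (hzM : z ∉ M) (hwM : w ∉ M) (hyz : y ≠ z) (hyw : y ≠ w) (hzw : z ≠ w)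
    (h : ↥M.powerset → ℝ) (c : ℝ) (J : ℤ) :
    Gen.gMt (realEnv3 M C a b y z w) (fun β => h β + c) (fun β => h β + c) J = Gen.gMt (realEnv3 M C a b y z w) h h J := by
  rw [Gen.gMt_self, Gen.gMt_self]
  have hzero : ∑ β : ↥M.powerset, ((realEnv3 M C a b y z w β).gslot1 J + (realEnv3 M C a b y z w β).gslot0 J) = 0 := by
    set S : ↥M.powerset → ℝ := fun β => (realEnv3 M C a b y z w β).gslot1 J + (realEnv3 M C a b y z w β).gslot0 J with hS
    let φ : ↥M.powerset ≃ ↥M.powerset :=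
      { toFun := fun β => ⟨M \ β.1, Finset.mem_powerset.2 Finset.sdiff_subset⟩
        invFun := fun β => ⟨M \ β.1, Finset.mem_powerset.2 Finset.sdiff_subset⟩
        left_inv := fun β => Subtype.ext (Finset.sdiff_sdiff_eq_self (Finset.mem_powerset.1 β.2))
        right_inv := fun β => Subtype.ext (Finset.sdiff_sdiff_eq_self (Finset.mem_powerset.1 β.2)) }
    have hflip : ∑ β, S β = ∑ β, S (φ β) := (Equiv.sum_comp φ S).symm
    have hneg : ∀ β, S (φ β) = -S β := fun β => realEnv3_slotSum_compl hyM hzM hwM hyz hyw hzw β J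
    simp only [hneg, Finset.sum_neg_distrib] at hflip
    linarith
  have : ∑ β : ↥M.powerset, (h β + c) * ((realEnv3 M C a b y z w β).gslot1 J + (realEnv3 M C a b y z w β).gslot0 J) =
      ∑ β : ↥M.powerset, h β * ((realEnv3 M C a b y z w β).gslot1 J + (realEnv3 M C a b y z w β).gslot0 J) +
        c * ∑ β : ↥M.powerset, ((realEnv3 M C a b y z w β).gslot1 J + (realEnv3 M C a b y z w β).gslot0 J) := by
    rw [Finset.mul_sum, ← Finset.sum_add_distrib]; exact Finset.sum_congr rfl fun β _ => by ring
  rw [this, hzero, mul_zero, add_zero]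

end RealEnv3

/-! ## The root identity for `T2_x` -/

section RootIdentity3

variable {V : Type*} [Fintype V] {M C : Finset (Sym2 V)} {a b : V} {y z w : Sym2 V}

omit [Fintype V] in
/-- Expanding a sum over the configurations of `M ∪ {x, y, z, w}` by the sixteen patterns of the four specials. [folklore] -/
theorem sum_powerset_insert₄ {x : Sym2 V} (hx : x ∉ insert y (insert z (insert w M))) (hy : y ∉ insert z (insert w M))
    (hz : z ∉ insert w M) (hw : w ∉ M) (F : Finset (Sym2 V) → ℝ) :
    ∑ γ ∈ (insert x (insert y (insert z (insert w M)))).powerset, F γ =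
      ∑ X ∈ M.powerset,
        ((F X + F (insert w X) + (F (insert z X) + F (insert z (insert w X))) +
          (F (insert y X) + F (insert y (insert w X)) + (F (insert y (insert z X)) + F (insert y (insert z (insert w X)))))) +
        (F (insert x X) + F (insert x (insert w X)) + (F (insert x (insert z X)) + F (insert x (insert z (insert w X)))) +
          (F (insert x (insert y X)) + F (insert x (insert y (insert w X))) +
            (F (insert x (insert y (insert z X))) + F (insert x (insert y (insert z (insert w X)))))))) := by
  rw [Finset.sum_powerset_insert hx, sum_powerset_insert₃ hy hz hw, sum_powerset_insert₃ hy hz hw, ← Finset.sum_add_distrib]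

/-- **THE ROOT IDENTITY FOR `T2_x`.**  Host `x ∥ 𝓔` (`x = ab` the root between the poles of `𝓔`; `y, z, w` the other specials; cell
`M ∪ {x,y,z,w}` free, `C` contracted; `x, y, z, w` pairwise distinct and off `M ∪ C`), `g` blind to `x, y, z, w`,
`f = T2_x = 1{(x ∧ (y ∨ z ∨ w)) ∨ (y ∧ z ∧ w)}`.  Then the level-`J` partial sum of the antipodal form of `f` against `g` is
`−Gen.gMt (realEnv3 M C a b y z w) ĝ ĝ (J+1)`, `ĝ(β) = g(β ∪ C) − g((M \ β) ∪ C)`. [cite: Grimmett2006, §1.4 eq. (1.20) (p. 15); §3.8 (pp. 61–62)] -/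
theorem host_root_identity3 (hxM : s(a, b) ∉ M) (hyM : y ∉ M) (hzM : z ∉ M) (hwM : w ∉ M)
    (hxC : s(a, b) ∉ C) (hyC : y ∉ C) (hzC : z ∉ C) (hwC : w ∉ C)
    (hxy : s(a, b) ≠ y) (hxz : s(a, b) ≠ z) (hxw : s(a, b) ≠ w) (hyz : y ≠ z) (hyw : y ≠ w) (hzw : z ≠ w)
    {g : Finset (Sym2 V) → ℝ} (hgx : ∀ A : Finset (Sym2 V), g (insert s(a, b) A) = g A)
    (hgy : ∀ A : Finset (Sym2 V), g (insert y A) = g A) (hgz : ∀ A : Finset (Sym2 V), g (insert z A) = g A)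
    (hgw : ∀ A : Finset (Sym2 V), g (insert w A) = g A) (J : ℕ) :
    ∑ γ ∈ (insert s(a, b) (insert y (insert z (insert w M)))).powerset,
        (if apExpC (insert s(a, b) (insert y (insert z (insert w M)))) C γ ≤ J then (1 : ℝ) else 0) *
          ((((fun X : Finset (Sym2 V) => if (s(a, b) ∈ X ∧ (y ∈ X ∨ z ∈ X ∨ w ∈ X)) ∨ (y ∈ X ∧ z ∈ X ∧ w ∈ X)
              then (1 : ℝ) else 0) (γ ∪ C)) -
            ((fun X : Finset (Sym2 V) => if (s(a, b) ∈ X ∧ (y ∈ X ∨ z ∈ X ∨ w ∈ X)) ∨ (y ∈ X ∧ z ∈ X ∧ w ∈ X)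
              then (1 : ℝ) else 0) ((insert s(a, b) (insert y (insert z (insert w M)))) \ γ ∪ C))) *
            (g (γ ∪ C) - g ((insert s(a, b) (insert y (insert z (insert w M)))) \ γ ∪ C))) =
      - Gen.gMt (realEnv3 M C a b y z w) (fun β => g (β.1 ∪ C) - g (M \ β.1 ∪ C)) (fun β => g (β.1 ∪ C) - g (M \ β.1 ∪ C))
          ((J : ℤ) + 1) := by
  have hzM1 : z ∉ insert w M := by rw [Finset.mem_insert, not_or]; exact ⟨hzw, hzM⟩
  have hyM1 : y ∉ insert z (insert w M) := by
    rw [Finset.mem_insert, not_or, Finset.mem_insert, not_or]; exact ⟨hyz, hyw, hyM⟩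
  have hxM2 : s(a, b) ∉ insert y (insert z (insert w M)) := by
    rw [Finset.mem_insert, not_or, Finset.mem_insert, not_or, Finset.mem_insert, not_or]; exact ⟨hxy, hxz, hxw, hxM⟩
  rw [sum_powerset_insert₄ hxM2 hyM1 hzM1 hwM, Gen.gMt_self, ← Finset.sum_neg_distrib, ← Finset.sum_coe_sort]
  refine Finset.sum_congr rfl fun β _ => ?_
  obtain ⟨X, hX⟩ := β
  obtain ⟨t0, ty, tz, tw, tyz, tyw, tzw, tu⟩ := patSet3_table y z w X
  have hXM : X ⊆ M := Finset.mem_powerset.1 hX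
  have hxX : s(a, b) ∉ X := fun h => hxM (hXM h)
  have hyX : y ∉ X := fun h => hyM (hXM h)
  have hzX : z ∉ X := fun h => hzM (hXM h)
  have hwX : w ∉ X := fun h => hwM (hXM h)
  -- the eight patterns as subsets of `M ∪ {y,z,w}`
  have sM : M ⊆ insert y (insert z (insert w M)) := ((Finset.subset_insert _ _).trans (Finset.subset_insert _ _)).trans (Finset.subset_insert _ _)
  have p0 : X ⊆ insert y (insert z (insert w M)) := hXM.trans sM
  have pw : insert w X ⊆ insert y (insert z (insert w M)) :=
    (Finset.insert_subset_insert _ hXM).trans ((Finset.subset_insert _ _).trans (Finset.subset_insert _ _))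
  have pz : insert z X ⊆ insert y (insert z (insert w M)) :=
    (Finset.insert_subset_insert _ (hXM.trans (Finset.subset_insert _ _))).trans (Finset.subset_insert _ _)
  have pzw : insert z (insert w X) ⊆ insert y (insert z (insert w M)) :=
    (Finset.insert_subset_insert _ (Finset.insert_subset_insert _ hXM)).trans (Finset.subset_insert _ _)
  have py : insert y X ⊆ insert y (insert z (insert w M)) :=
    Finset.insert_subset_insert _ (hXM.trans ((Finset.subset_insert _ _).trans (Finset.subset_insert _ _)))
  have pyw : insert y (insert w X) ⊆ insert y (insert z (insert w M)) :=
    Finset.insert_subset_insert _ ((Finset.insert_subset_insert _ hXM).trans (Finset.subset_insert _ _))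
  have pyz : insert y (insert z X) ⊆ insert y (insert z (insert w M)) :=
    Finset.insert_subset_insert _ (Finset.insert_subset_insert _ (hXM.trans (Finset.subset_insert _ _)))
  have pyzw : insert y (insert z (insert w X)) ⊆ insert y (insert z (insert w M)) :=
    Finset.insert_subset_insert _ (Finset.insert_subset_insert _ (Finset.insert_subset_insert _ hXM))
  -- the root edge's level bookkeeping, sixteen times
  have k10 := apExpC_insert_root_live₁ (C := C) (γ := X) hxM2
  have k1w := apExpC_insert_root_live₁ (C := C) (γ := insert w X) hxM2
  have k1z := apExpC_insert_root_live₁ (C := C) (γ := insert z X) hxM2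
  have k1zw := apExpC_insert_root_live₁ (C := C) (γ := insert z (insert w X)) hxM2
  have k1y := apExpC_insert_root_live₁ (C := C) (γ := insert y X) hxM2
  have k1yw := apExpC_insert_root_live₁ (C := C) (γ := insert y (insert w X)) hxM2
  have k1yz := apExpC_insert_root_live₁ (C := C) (γ := insert y (insert z X)) hxM2
  have k1yzw := apExpC_insert_root_live₁ (C := C) (γ := insert y (insert z (insert w X))) hxM2
  have k20 := apExpC_insert_root_live₂ (C := C) hxM2 p0
  have k2w := apExpC_insert_root_live₂ (C := C) hxM2 pw
  have k2z := apExpC_insert_root_live₂ (C := C) hxM2 pz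
  have k2zw := apExpC_insert_root_live₂ (C := C) hxM2 pzw
  have k2y := apExpC_insert_root_live₂ (C := C) hxM2 py
  have k2yw := apExpC_insert_root_live₂ (C := C) hxM2 pyw
  have k2yz := apExpC_insert_root_live₂ (C := C) hxM2 pyz
  have k2yzw := apExpC_insert_root_live₂ (C := C) hxM2 pyzw
  simp only [root_le_iff k10, root_le_iff k1w, root_le_iff k1z, root_le_iff k1zw, root_le_iff k1y, root_le_iff k1yw,
    root_le_iff k1yz, root_le_iff k1yzw, root_le_iff k20, root_le_iff k2w, root_le_iff k2z, root_le_iff k2zw, root_le_iff k2y,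
    root_le_iff k2yw, root_le_iff k2yz, root_le_iff k2yzw]
  -- unfold the right-hand side (eight explicit patterns) and normalise both sides
  rw [Gen.EDat.gslot_sum, Base3.sum_mixed_fin3]
  simp only [realEnv3_d, t0, ty, tz, tw, tyz, tyw, tzw, tu]
  simp only [realPDat, PDat.a1, PDat.a2, bit, ind, reachB, decide_eq_true_eq,
    Finset.mem_union, Finset.mem_insert, Finset.mem_sdiff, Finset.insert_sdiff_insert, Finset.sdiff_insert_of_notMem,
    Finset.insert_sdiff_of_notMem, Finset.insert_union, hgx, hgy, hgz, hgw,
    hxy, hxz, hxw, hyz, hyw, hzw, hxy.symm, hxz.symm, hxw.symm, hyz.symm, hyw.symm, hzw.symm,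
    hxX, hyX, hzX, hwX, hxM, hyM, hzM, hwM, hxC, hyC, hzC, hwC,
    or_true, or_false, and_true, and_false, if_true, if_false, not_false_iff]
  ring

/-- **THEOREM (the `q`-free `T2_x` inequality of a host from fact 1 of its three-special environment).**  Host `x ∥ 𝓔` as in
`host_root_identity3`; if the generic root functional of the real three-special environment of `𝓔` is nonnegative against every monotone
nonnegative weight (`Gen.gMt (realEnv3 M C a b y z w) h h J ≥ 0` — fact 1 of the generic word theorem), then for every increasing `g` blind to
`x, y, z, w` and every level `J`, the level-`J` partial sum of the antipodal form of `T2_x = ω_x·(ω_y ∨ ω_z ∨ ω_w) ∨ ω_yω_zω_w` against `g` on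
the cell `(M ∪ {x,y,z,w}, C)` is `≤ 0`: every coefficient — in the edge odds and in `q` — of `Z_H(z,q)² Cov_{φ_{z,q}}(T2_x, g)/(q−1)` on this
cell is nonnegative. [cite: Grimmett2006, §1.4 eq. (1.20) (p. 15); §3.8 (pp. 61–62)] [cite: Wagner2006, Thm. 5.8(d), §5.3] -/
theorem t2_levels_le_nonpos_of_rootFact3 (hxM : s(a, b) ∉ M) (hyM : y ∉ M) (hzM : z ∉ M) (hwM : w ∉ M)
    (hxC : s(a, b) ∉ C) (hyC : y ∉ C) (hzC : z ∉ C) (hwC : w ∉ C)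
    (hxy : s(a, b) ≠ y) (hxz : s(a, b) ≠ z) (hxw : s(a, b) ≠ w) (hyz : y ≠ z) (hyw : y ≠ w) (hzw : z ≠ w)
    (hfact : ∀ h : ↥M.powerset → ℝ, Monotone h → (∀ β, 0 ≤ h β) → ∀ J : ℤ, 0 ≤ Gen.gMt (realEnv3 M C a b y z w) h h J)
    {g : Finset (Sym2 V) → ℝ} (hgx : ∀ A : Finset (Sym2 V), g (insert s(a, b) A) = g A)
    (hgy : ∀ A : Finset (Sym2 V), g (insert y A) = g A) (hgz : ∀ A : Finset (Sym2 V), g (insert z A) = g A)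
    (hgw : ∀ A : Finset (Sym2 V), g (insert w A) = g A)
    (hmono : ∀ ⦃X Y : Finset (Sym2 V)⦄, X ⊆ Y → g X ≤ g Y) (J : ℕ) :
    ∑ γ ∈ (insert s(a, b) (insert y (insert z (insert w M)))).powerset with
        apExpC (insert s(a, b) (insert y (insert z (insert w M)))) C γ ≤ J,
        ((((fun X : Finset (Sym2 V) => if (s(a, b) ∈ X ∧ (y ∈ X ∨ z ∈ X ∨ w ∈ X)) ∨ (y ∈ X ∧ z ∈ X ∧ w ∈ X)
              then (1 : ℝ) else 0) (γ ∪ C)) -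
            ((fun X : Finset (Sym2 V) => if (s(a, b) ∈ X ∧ (y ∈ X ∨ z ∈ X ∨ w ∈ X)) ∨ (y ∈ X ∧ z ∈ X ∧ w ∈ X)
              then (1 : ℝ) else 0) ((insert s(a, b) (insert y (insert z (insert w M)))) \ γ ∪ C))) *
          (g (γ ∪ C) - g ((insert s(a, b) (insert y (insert z (insert w M)))) \ γ ∪ C))) ≤ 0 := by
  have key := host_root_identity3 (C := C) hxM hyM hzM hwM hxC hyC hzC hwC hxy hxz hxw hyz hyw hzw hgx hgy hgz hgw J
  have hpos := hfact (fun β => (g (β.1 ∪ C) - g (M \ β.1 ∪ C)) + (g (M ∪ C) - g C))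
    (fun β β' hle => add_le_add_left (incr_mono hmono M C hle) _)
    (fun β => by
      have h1 : g C ≤ g (β.1 ∪ C) := hmono Finset.subset_union_right
      have h2 : g (M \ β.1 ∪ C) ≤ g (M ∪ C) := hmono (Finset.union_subset_union Finset.sdiff_subset le_rfl)
      linarith) ((J : ℤ) + 1)
  rw [gMt_realEnv3_add_const hyM hzM hwM hyz hyw hzw] at hpos
  rw [Finset.sum_filter]
  have hsum : ∀ (S : Finset (Finset (Sym2 V))) (lev : Finset (Sym2 V) → ℕ) (F : Finset (Sym2 V) → ℝ),
      ∑ γ ∈ S, (if lev γ ≤ J then F γ else 0) = ∑ γ ∈ S, (if lev γ ≤ J then (1 : ℝ) else 0) * F γ :=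
    fun S lev F => Finset.sum_congr rfl fun γ _ => by split_ifs <;> ring
  rw [hsum, key]
  linarith

end RootIdentity3

end RootForm

end FK

end Summit.CriticalPhenomena.PercolationContinuityZ3.Theorems

end
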